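import Summits.QuantumFields.BalabanUV.Beta.GAN24.ResolventLegCharges
import Summits.QuantumFields.BalabanUV.Beta.CoDressedMmRead
import Summits.QuantumFields.BalabanUV.Beta.GAN24.CoDressedColumnSourceSums

/-!
# `BalabanUV.Beta.GAN24.SandwichReadoutSiteDep` — binder row G-an2-4 ∕ (CONV-C), CT-W (F2) FIRST TEST, tool (t1): **THE SANDWICH READ-OUT FUBINI WITH SITE-DEPENDENT
# COARSE-LEG CHARGES** (the dressed kernel `G_j = coDressKBmAt ρ Lc (KInvStep Lc j)` has FACE-WEIGHTED (Q-lin) charges — `HOME/b2b-balaban-gan24-p2/gen35/CT-W-F2-FIRST-TEST-v0.md` §2)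
NOT IN PRINT; OUR BOOKKEEPING (road-P2 chair of row G-an2-4, unit `b2b-balaban-gan24-p2` gen 35, crux team (2); OWNER ruling R-gan24p1-g22-1 (W5) «(F2) FIRST TEST GO»).
HONEST FRAMING (cell contract, verbatim): «discharging `BetaPertH` makes Bałaban's UV stability UNCONDITIONAL — a real constructive-QFT result; it is NOT the continuum
limit and NOT the Clay problem.»  HONEST DEPENDENCY (verbatim): «continuum YM on T⁴ ⇐ BetaPertH ∧ nine spine estimates (0/9 proved); BetaPertH ⇐ (D1) ∧ (D4) ∧ CAP+tail;
G-an2-4 gates asym, D1 and NE2/3/4.»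

WHAT ([folklore]; generic `d`, `N ≥ 1`; 0 `def`, 0 cite, 0 sorry).  §1 **`hasSum_sandwich_readout_dep`** — leaf-06's `ResolventLegCharges.hasSum_sandwich_readout` with the
coarse-leg charges allowed to DEPEND ON THE FREE LEG's SITE: if `K` decays and `HasSum (x′ ↦ K (N•x′) y (inr α) f) (ρL f y)`, `HasSum (z′ ↦ K w (N•z′) g (inr β)) (ρR g w)` for all legs,
then for every bi-localised `V` the `mm`-entries of `K ∘ V ∘ K` at the coarse points have the double-leg `HasSum` `Σ'_{(y,w)} Σ_{f,g} ρL f y · V y w f g · ρR g w` (same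
majorant, same Fubini; the site-free case is `ρL f y := ρL f`).  §2 THE CO-DRESSED KERNEL `G = coDressKBmAt ρ N K = piKBmᵀ ∘ K ∘ piKBm` (asym1 ∕ an2): its
coarse-leg CHARGES **`hasSum_coDressKBmAt_row ∕ _col`** — `HasSum` packagings of leaf-02 g51's `CoDressedColumnSourceSums.tsum_source_rowH_coDressKBmAt ∕ tsum_source_colH_coDressKBmAt`
(✓ p310002) + an2's `CoDressedMmRead.coDressKBmAt_inr_inr`: from site-free charges `cL ∕ cR` of `K` on field legs and zero on multiplier legs they are SITE-DEPENDENT, `N·cL` on the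
EXIT-FACE bonds and `0` inside blocks (multiplier legs untouched); and **`hasSum_sandwich_readout_coDressKBmAt`** — §1 at `G`: ONLY the ff double-leg sum of `V` survives, RESTRICTED TO
THE EXIT FACES in both legs, weight `N²`.  This is tool (t1) of the (F2) first test: it reduces `zmode (b̃_j) = 0` to the FACE-RESTRICTED channel identities (memo §2).  Asserts NO value of Bałaban's tables; discharges NOTHING of
(F2), «T2Shape», (hW, hWall); NEVER «G-an2-4 closed»; NOT D1, NOT BetaPertH, NOT continuum, NOT Clay.  2026-08-21.
-/

noncomputable section

open Finset
open scoped BigOperators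
open Literature.MathematicalPhysics.QuantumFieldTheory
open Literature.MathematicalPhysics.QuantumFieldTheory.Balaban1983to89
open Literature.MathematicalPhysics.QuantumFieldTheory.Balaban1983to89.Beta
open B12Sec2to5 (l1 l1_nonneg summable_exp_neg_l1)
open ExpKernelCalculus (Site MKer BiLoc Decays comp l1_natSmul l1_sub_triangle l1_sub_symm Zl Zl_nonneg summable_exp_shift
  summable_exp_shift' tsum_exp_shift tsum_exp_shift')
open OneStepResolventKernel (Fib)
open AffineAveraging (box toSite)
open OneStepKernelFamily (colH)
open Summit.QuantumFields.BalabanUV.Beta.AxialDressingRooted (coDressKBmAt coDressKBmAt_inr_inr decays_coDressKBmAt)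
open Summit.QuantumFields.BalabanUV.Beta.GAN24.CoDressedColumnSourceSums (rowH_coDressKBmAt summable_window_term_row tsum_source_rowH_coDressKBmAt summable_source_colH_coDressKBmAt tsum_source_colH_coDressKBmAt)
open Summit.QuantumFields.BalabanUV.Beta.GAN24.KernelLegCharges (summable_exp_coarse)
open Summit.QuantumFields.BalabanUV.Beta.GAN24.ResolventLegCharges (summable_exp_coarse' tsum_exp_coarse_le tsum_exp_coarse_le' summable_legs_prod)

namespace Summit.QuantumFields.BalabanUV.Beta.GAN24.SandwichReadoutSiteDep

variable {d : ℕ} {N : ℕ}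

/-- [folklore] **THE SANDWICH READ-OUT FUBINI, SITE-DEPENDENT CHARGES.**  Let `K` decay (rate `δ > 0`) and have coarse-leg charges against the multiplier legs `inr α` (rows,
`ρL f y` — MAY depend on the free leg's site `y`) and `inr β` (columns, `ρR g w`); let `V` be bi-localised.  Then the `mm`-entries of `K ∘ V ∘ K` read at the coarse points have the
double-leg `HasSum` `Σ'_{(y,w)} Σ_{f,g} ρL f y · V y w f g · ρR g w` (leaf-06's `hasSum_sandwich_readout` is the site-free case; proof verbatim theirs). -/
theorem hasSum_sandwich_readout_dep [NeZero N] {K V : MKer (d + 1) (Fib d)} {C δ Cv δv : ℝ} {p q : Site (d + 1)} (hK : Decays K C δ) (hδ : 0 < δ)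
    (hV : BiLoc V p q Cv δv) (hδv : 0 < δv) (α β : Fin (d + 1)) {ρL ρR : Fib d → Site (d + 1) → ℝ}
    (hrow : ∀ f y, HasSum (fun x' : Site (d + 1) => K ((N : ℤ) • x') y (Sum.inr α) f) (ρL f y))
    (hcol : ∀ g w, HasSum (fun z' : Site (d + 1) => K w ((N : ℤ) • z') g (Sum.inr β)) (ρR g w)) :
    HasSum (fun xz : Site (d + 1) × Site (d + 1) => comp (comp K V) K ((N : ℤ) • xz.1) ((N : ℤ) • xz.2) (Sum.inr α) (Sum.inr β))
      (∑' yw : Site (d + 1) × Site (d + 1), ∑ f, ∑ g, ρL f yw.1 * V yw.1 yw.2 f g * ρR g yw.2) := by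
  classical
  have hN : 1 ≤ N := Nat.one_le_iff_ne_zero.2 (NeZero.ne N)
  have hC : 0 ≤ C := hK.nonneg (Sum.inl 0)
  have hCv : 0 ≤ Cv := hV.nonneg (Sum.inl 0)
  set cF : ℝ := ((Fintype.card (Fib d) : ℕ) : ℝ) with hcF
  -- the four-leg family, outer index `(y, w)`, inner index `(x′, z′)`
  set Φ : Site (d + 1) × Site (d + 1) → Site (d + 1) × Site (d + 1) → ℝ := fun yw xz =>
    ∑ f, ∑ g, K ((N : ℤ) • xz.1) yw.1 (Sum.inr α) f * V yw.1 yw.2 f g * K yw.2 ((N : ℤ) • xz.2) g (Sum.inr β) with hΦ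
  -- the majorant and its sums
  set U : ℝ := Real.exp (δ * ((N : ℝ) * (d + 1))) * Zl (d + 1) δ with hU
  set M : Site (d + 1) × Site (d + 1) → Site (d + 1) × Site (d + 1) → ℝ := fun yw xz =>
    (cF * cF * (C * Cv * C) * Real.exp (-δv * (l1 (yw.1 - p) + l1 (yw.2 - q)))) *
      (Real.exp (-δ * l1 ((N : ℤ) • xz.1 - yw.1)) * Real.exp (-δ * l1 (yw.2 - (N : ℤ) • xz.2))) with hM
  have hM0 : ∀ yw xz, 0 ≤ M yw xz := fun yw xz => by positivity
  have hΦM : ∀ yw xz, |Φ yw xz| ≤ M yw xz := by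
    intro yw xz
    have hterm : ∀ f g, |K ((N : ℤ) • xz.1) yw.1 (Sum.inr α) f * V yw.1 yw.2 f g * K yw.2 ((N : ℤ) • xz.2) g (Sum.inr β)| ≤
        (C * Real.exp (-δ * l1 ((N : ℤ) • xz.1 - yw.1))) * (Cv * Real.exp (-δv * (l1 (yw.1 - p) + l1 (yw.2 - q)))) *
          (C * Real.exp (-δ * l1 (yw.2 - (N : ℤ) • xz.2))) := by
      intro f g
      rw [abs_mul, abs_mul]
      have e1 := hK ((N : ℤ) • xz.1) yw.1 (Sum.inr α) f
      have e2 := hV yw.1 yw.2 f g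
      have e3 := hK yw.2 ((N : ℤ) • xz.2) g (Sum.inr β)
      exact mul_le_mul (mul_le_mul e1 e2 (abs_nonneg _) ((abs_nonneg _).trans e1)) e3 (abs_nonneg _)
        (mul_nonneg ((abs_nonneg _).trans e1) ((abs_nonneg _).trans e2))
    calc |Φ yw xz| ≤ ∑ f, ∑ g, |K ((N : ℤ) • xz.1) yw.1 (Sum.inr α) f * V yw.1 yw.2 f g * K yw.2 ((N : ℤ) • xz.2) g (Sum.inr β)| :=
          (Finset.abs_sum_le_sum_abs _ _).trans (Finset.sum_le_sum fun f _ => Finset.abs_sum_le_sum_abs _ _)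
      _ ≤ ∑ _f : Fib d, ∑ _g : Fib d, (C * Real.exp (-δ * l1 ((N : ℤ) • xz.1 - yw.1))) *
            (Cv * Real.exp (-δv * (l1 (yw.1 - p) + l1 (yw.2 - q)))) * (C * Real.exp (-δ * l1 (yw.2 - (N : ℤ) • xz.2))) :=
          Finset.sum_le_sum fun f _ => Finset.sum_le_sum fun g _ => hterm f g
      _ = M yw xz := by
          simp only [Finset.sum_const, Finset.card_univ, nsmul_eq_mul, hM, hcF]
          ring
  -- inner sums of the majorant
  have hMin : ∀ yw, HasSum (fun xz => M yw xz)
      ((cF * cF * (C * Cv * C) * Real.exp (-δv * (l1 (yw.1 - p) + l1 (yw.2 - q)))) *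
        ((∑' x' : Site (d + 1), Real.exp (-δ * l1 ((N : ℤ) • x' - yw.1))) *
          ∑' z' : Site (d + 1), Real.exp (-δ * l1 (yw.2 - (N : ℤ) • z')))) := by
    intro yw
    have h1 := summable_exp_coarse (d := d) hN hδ yw.1
    have h2 := summable_exp_coarse' (d := d) hN hδ yw.2
    have h12 := h1.hasSum.mul h2.hasSum (h1.mul_of_nonneg h2 (fun _ => (Real.exp_pos _).le) (fun _ => (Real.exp_pos _).le))
    exact h12.mul_left _
  have hMs : Summable (Function.uncurry M) := by
    refine (summable_prod_of_nonneg (fun s => hM0 s.1 s.2)).2 ⟨fun yw => (hMin yw).summable, ?_⟩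
    have hbound : ∀ yw : Site (d + 1) × Site (d + 1), ∑' xz, M yw xz ≤
        (cF * cF * (C * Cv * C) * (U * U)) * (Real.exp (-δv * l1 (yw.1 - p)) * Real.exp (-δv * l1 (yw.2 - q))) := by
      intro yw
      rw [(hMin yw).tsum_eq, mul_add, Real.exp_add]
      have hA := tsum_exp_coarse_le (d := d) N hδ yw.1
      have hB := tsum_exp_coarse_le' (d := d) N hδ yw.2
      have hA0 : 0 ≤ ∑' x' : Site (d + 1), Real.exp (-δ * l1 ((N : ℤ) • x' - yw.1)) := tsum_nonneg fun _ => (Real.exp_pos _).le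
      have hB0 : 0 ≤ ∑' z' : Site (d + 1), Real.exp (-δ * l1 (yw.2 - (N : ℤ) • z')) := tsum_nonneg fun _ => (Real.exp_pos _).le
      have hU0 : 0 ≤ U := mul_nonneg (Real.exp_pos _).le (Zl_nonneg hδ)
      have hAB := mul_le_mul hA hB hB0 hU0
      have hc0 : 0 ≤ cF * cF * (C * Cv * C) * (Real.exp (-δv * l1 (yw.1 - p)) * Real.exp (-δv * l1 (yw.2 - q))) := by positivity
      calc cF * cF * (C * Cv * C) * (Real.exp (-δv * l1 (yw.1 - p)) * Real.exp (-δv * l1 (yw.2 - q))) *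
            ((∑' x' : Site (d + 1), Real.exp (-δ * l1 ((N : ℤ) • x' - yw.1))) * ∑' z' : Site (d + 1), Real.exp (-δ * l1 (yw.2 - (N : ℤ) • z')))
          ≤ cF * cF * (C * Cv * C) * (Real.exp (-δv * l1 (yw.1 - p)) * Real.exp (-δv * l1 (yw.2 - q))) * (U * U) :=
            mul_le_mul_of_nonneg_left hAB hc0
        _ = _ := by ring
    have hsum : Summable fun yw : Site (d + 1) × Site (d + 1) =>
        (cF * cF * (C * Cv * C) * (U * U)) * (Real.exp (-δv * l1 (yw.1 - p)) * Real.exp (-δv * l1 (yw.2 - q))) :=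
      ((summable_exp_shift' hδv p).mul_of_nonneg (summable_exp_shift' hδv q) (fun _ => (Real.exp_pos _).le)
        (fun _ => (Real.exp_pos _).le)).mul_left _
    exact Summable.of_nonneg_of_le (fun yw => tsum_nonneg fun xz => hM0 yw xz) hbound hsum
  -- (A) absolute summability of the four-leg family
  have hΦs : Summable (Function.uncurry Φ) :=
    Summable.of_norm_bounded hMs (fun s => by rw [Real.norm_eq_abs]; exact hΦM s.1 s.2)
  -- (C) the inner sums: only the charges survive
  have hΦin : ∀ yw : Site (d + 1) × Site (d + 1), HasSum (fun xz => Φ yw xz) (∑ f, ∑ g, ρL f yw.1 * V yw.1 yw.2 f g * ρR g yw.2) := by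
    intro yw
    refine hasSum_sum fun f _ => hasSum_sum fun g _ => ?_
    have hmul := ((hrow f yw.1).mul (hcol g yw.2) (summable_legs_prod hK hδ yw.1 yw.2 _ _ f g)).mul_left (V yw.1 yw.2 f g)
    rw [show V yw.1 yw.2 f g * (ρL f yw.1 * ρR g yw.2) = ρL f yw.1 * V yw.1 yw.2 f g * ρR g yw.2 by ring] at hmul
    exact hmul.congr_fun fun xz => by ring
  -- (B) the pointwise identity: the nested composition IS the `(y, w)`-sum of `Φ`
  have hΦyw : ∀ xz : Site (d + 1) × Site (d + 1), Summable fun yw : Site (d + 1) × Site (d + 1) => Φ yw xz :=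
    fun xz => hΦs.prod_symm.prod_factor xz
  have hpoint : ∀ xz : Site (d + 1) × Site (d + 1),
      comp (comp K V) K ((N : ℤ) • xz.1) ((N : ℤ) • xz.2) (Sum.inr α) (Sum.inr β) = ∑' yw : Site (d + 1) × Site (d + 1), Φ yw xz := by
    intro xz
    -- summability of the `(w, y)`-ordered family and of its `y`-slices with one fibre index fixed
    have hwy : Summable fun wy : Site (d + 1) × Site (d + 1) => Φ (wy.2, wy.1) xz :=
      (Equiv.prodComm (Site (d + 1)) (Site (d + 1))).summable_iff.2 (hΦyw xz) |>.congr fun wy => rfl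
    have hslice : ∀ (w : Site (d + 1)) (g : Fib d), Summable fun y : Site (d + 1) =>
        ∑ f, K ((N : ℤ) • xz.1) y (Sum.inr α) f * V y w f g * K w ((N : ℤ) • xz.2) g (Sum.inr β) := by
      intro w g
      have hmaj : Summable fun y : Site (d + 1) => (cF * (C * Cv * (C * Real.exp (-δ * l1 (w - (N : ℤ) • xz.2))))) *
          Real.exp (-δ * l1 ((N : ℤ) • xz.1 - y)) := (summable_exp_shift hδ _).mul_left _
      refine Summable.of_norm_bounded hmaj (fun y => ?_)
      rw [Real.norm_eq_abs]
      have hterm : ∀ f, |K ((N : ℤ) • xz.1) y (Sum.inr α) f * V y w f g * K w ((N : ℤ) • xz.2) g (Sum.inr β)| ≤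
          (C * Real.exp (-δ * l1 ((N : ℤ) • xz.1 - y))) * Cv * (C * Real.exp (-δ * l1 (w - (N : ℤ) • xz.2))) := by
        intro f
        rw [abs_mul, abs_mul]
        have e1 := hK ((N : ℤ) • xz.1) y (Sum.inr α) f
        have e2 : |V y w f g| ≤ Cv := by
          refine (hV y w f g).trans ?_
          have : Real.exp (-δv * (l1 (y - p) + l1 (w - q))) ≤ 1 :=
            Real.exp_le_one_iff.2 (by nlinarith [l1_nonneg (y - p), l1_nonneg (w - q)])
          nlinarith
        have e3 := hK w ((N : ℤ) • xz.2) g (Sum.inr β)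
        exact mul_le_mul (mul_le_mul e1 e2 (abs_nonneg _) ((abs_nonneg _).trans e1)) e3 (abs_nonneg _)
          (mul_nonneg ((abs_nonneg _).trans e1) ((abs_nonneg _).trans e2))
      calc |∑ f, K ((N : ℤ) • xz.1) y (Sum.inr α) f * V y w f g * K w ((N : ℤ) • xz.2) g (Sum.inr β)|
          ≤ ∑ f, |K ((N : ℤ) • xz.1) y (Sum.inr α) f * V y w f g * K w ((N : ℤ) • xz.2) g (Sum.inr β)| := Finset.abs_sum_le_sum_abs _ _
        _ ≤ ∑ _f : Fib d, (C * Real.exp (-δ * l1 ((N : ℤ) • xz.1 - y))) * Cv * (C * Real.exp (-δ * l1 (w - (N : ℤ) • xz.2))) :=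
            Finset.sum_le_sum fun f _ => hterm f
        _ = _ := by simp only [Finset.sum_const, Finset.card_univ, nsmul_eq_mul, hcF]; ring
    -- rewrite the nested composition
    have hinner : ∀ w : Site (d + 1), ∑ g, comp K V ((N : ℤ) • xz.1) w (Sum.inr α) g * K w ((N : ℤ) • xz.2) g (Sum.inr β)
        = ∑' y : Site (d + 1), Φ (y, w) xz := by
      intro w
      have e1 : ∀ g, comp K V ((N : ℤ) • xz.1) w (Sum.inr α) g * K w ((N : ℤ) • xz.2) g (Sum.inr β)
          = ∑' y : Site (d + 1), ∑ f, K ((N : ℤ) • xz.1) y (Sum.inr α) f * V y w f g * K w ((N : ℤ) • xz.2) g (Sum.inr β) := by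
        intro g
        simp only [comp]
        rw [← tsum_mul_right]
        exact tsum_congr fun y => by rw [Finset.sum_mul]
      simp_rw [e1]
      rw [(Summable.tsum_finsetSum fun g _ => hslice w g).symm]
      exact tsum_congr fun y => Finset.sum_comm
    calc comp (comp K V) K ((N : ℤ) • xz.1) ((N : ℤ) • xz.2) (Sum.inr α) (Sum.inr β)
        = ∑' w : Site (d + 1), ∑' y : Site (d + 1), Φ (y, w) xz := by
          simp only [comp] at hinner ⊢
          exact tsum_congr fun w => hinner w
      _ = ∑' wy : Site (d + 1) × Site (d + 1), Φ (wy.2, wy.1) xz := (hwy.tsum_prod).symm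
      _ = ∑' yw : Site (d + 1) × Site (d + 1), Φ yw xz :=
          (Equiv.prodComm (Site (d + 1)) (Site (d + 1))).tsum_eq (fun yw : Site (d + 1) × Site (d + 1) => Φ yw xz)
  -- (D) assemble
  have hF : Summable fun xz : Site (d + 1) × Site (d + 1) => ∑' yw : Site (d + 1) × Site (d + 1), Φ yw xz := hΦs.prod_symm.prod
  have hval : ∑' xz : Site (d + 1) × Site (d + 1), ∑' yw : Site (d + 1) × Site (d + 1), Φ yw xz
      = ∑' yw : Site (d + 1) × Site (d + 1), ∑ f, ∑ g, ρL f yw.1 * V yw.1 yw.2 f g * ρR g yw.2 := by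
    rw [hΦs.tsum_comm]
    exact tsum_congr fun yw => (hΦin yw).tsum_eq
  have h := hF.hasSum
  rw [hval] at h
  exact h.congr_fun fun xz => hpoint xz

/-! ## §2 The co-dressed kernel's coarse-leg charges (leaf-02 g51's source sums BY NAME) and the sandwich read-out through it -/

section CoDressed

variable {r : Fin (d + 1) → ℕ}

/-- NOT IN PRINT; OUR BOOKKEEPING ([folklore] `HasSum` packaging of leaf-02 g51's `CoDressedColumnSourceSums.tsum_source_rowH_coDressKBmAt` + an2's `CoDressedMmRead.coDressKBmAt_inr_inr`).
**THE ROW CHARGES OF THE CO-DRESSED KERNEL ARE SITE-DEPENDENT (FACE-WEIGHTED)**: if `K` has site-free row charges `cL α κ` on field legs and ZERO on multiplier legs ((S2c)), then for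
`G = coDressKBmAt (toSite r) N K` (in-block root): `HasSum (x′ ↦ G (N•x′) y (inr α) f) (ρ̃L f y)` with `ρ̃L (inl a) y = if y a % N = N − 1 then N · cL α a else 0` (EXIT-FACE bonds of
direction `a` carry `N·cL`, interior bonds carry `0` — `Π_bm` of the constant one-form, gan24-p4's `PiBmConstants.coProjBmW_const`) and `ρ̃L (inr m) y = 0`. -/
theorem hasSum_coDressKBmAt_row (hN : 1 ≤ N) (hr : r ∈ box (d + 1) N) {K : MKer (d + 1) (Fib d)} {cL : Fin (d + 1) → Fin (d + 1) → ℝ}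
    (hL : ∀ (t : Fin (d + 1) → ℤ) (α κ : Fin (d + 1)), HasSum (fun x' : Fin (d + 1) → ℤ => K ((N : ℤ) • x') t (Sum.inr α) (Sum.inl κ)) (cL α κ))
    (hL0 : ∀ (t : Fin (d + 1) → ℤ) (α m : Fin (d + 1)), HasSum (fun x' : Fin (d + 1) → ℤ => K ((N : ℤ) • x') t (Sum.inr α) (Sum.inr m)) 0)
    (α : Fin (d + 1)) (f : Fib d) (y : Site (d + 1)) :
    HasSum (fun x' : Site (d + 1) => coDressKBmAt (toSite r) N K ((N : ℤ) • x') y (Sum.inr α) f)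
      (Sum.elim (fun a => if y a % (N : ℤ) = (N : ℤ) - 1 then (N : ℝ) * cL α a else 0) (fun _ => (0 : ℝ)) f) := by
  rcases f with a | m
  · have hsum : Summable fun x' : Site (d + 1) => coDressKBmAt (toSite r) N K ((N : ℤ) • x') y (Sum.inr α) (Sum.inl a) := by
      simp_rw [rowH_coDressKBmAt]
      exact summable_sum fun v _ => summable_sum fun κ _ => summable_window_term_row r hL α a κ y v
    rw [Sum.elim_inl, ← tsum_source_rowH_coDressKBmAt hN hr hL α a y]
    exact hsum.hasSum
  · simp_rw [coDressKBmAt_inr_inr]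
    exact hL0 y α m

/-- NOT IN PRINT; OUR BOOKKEEPING (`HasSum` packaging of leaf-02 g51's `tsum_source_colH_coDressKBmAt`).  **THE COLUMN CHARGES OF THE CO-DRESSED KERNEL**:
`HasSum (z′ ↦ G w (N•z′) g (inr β)) (ρ̃R g w)`, `ρ̃R (inl b) w = if w b % N = N − 1 then N · cR b β else 0`, `ρ̃R (inr m) w = 0`. -/
theorem hasSum_coDressKBmAt_col (hN : 1 ≤ N) (hr : r ∈ box (d + 1) N) {K : MKer (d + 1) (Fib d)} {cR : Fin (d + 1) → Fin (d + 1) → ℝ}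
    (hR : ∀ (u : Fin (d + 1) → ℤ) (κ' μ : Fin (d + 1)), HasSum (fun y : Fin (d + 1) → ℤ => K u ((N : ℤ) • y) (Sum.inl κ') (Sum.inr μ)) (cR κ' μ))
    (hR0 : ∀ (u : Fin (d + 1) → ℤ) (m μ : Fin (d + 1)), HasSum (fun y : Fin (d + 1) → ℤ => K u ((N : ℤ) • y) (Sum.inr m) (Sum.inr μ)) 0)
    (β : Fin (d + 1)) (g : Fib d) (w : Site (d + 1)) :
    HasSum (fun z' : Site (d + 1) => coDressKBmAt (toSite r) N K w ((N : ℤ) • z') g (Sum.inr β))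
      (Sum.elim (fun b => if w b % (N : ℤ) = (N : ℤ) - 1 then (N : ℝ) * cR b β else 0) (fun _ => (0 : ℝ)) g) := by
  rcases g with b | m
  · have h := (summable_source_colH_coDressKBmAt r hR β b w).hasSum
    rw [tsum_source_colH_coDressKBmAt hN hr hR β b w] at h
    simpa only [colH, Sum.elim_inl] using h
  · simp_rw [coDressKBmAt_inr_inr]
    exact hR0 w m β

/-- NOT IN PRINT; OUR BOOKKEEPING ([folklore] §1 at the co-dressed kernel).  **THE SANDWICH READ-OUT THROUGH THE CO-DRESSED KERNEL** (in-block root): for `G = coDressKBmAt (toSite r) N K`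
with `K` decaying and carrying SITE-FREE charges `cL ∕ cR` on field legs and zero on multiplier legs ((Q-lin)∕(S2c) — `LinT2ZeroModeStep.hasSum_KInvStep_row ∕ _col` for
`K = KInvStep Lc j`), and any bi-localised `V`:
`HasSum ((x′,z′) ↦ (G ∘ V ∘ G)(N•x′, N•z′)_{(inr α, inr β)}) (Σ'_{(y,w)} Σ_{a,b} [y_a % N = N−1]·N·cL α a · V y w (inl a) (inl b) · [w_b % N = N−1]·N·cR b β)` —
ONLY the field–field double-leg sum of `V` survives, RESTRICTED TO THE EXIT-FACE BONDS in both legs and weighted `N²` (vs. leaf-06's site-free `ρL·ρR·Σ V` for `K` itself: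
`WSlotSourceZeroMode.sandwich_transfer`).  This is tool (t1) of the (F2) first test: `zmode (b̃_j) = 0` ⟺ these face-restricted channel sums vanish after the bond sums. -/
theorem hasSum_sandwich_readout_coDressKBmAt [NeZero N] (hN : 1 ≤ N) (hr : r ∈ box (d + 1) N) {K V : MKer (d + 1) (Fib d)}
    {C δ Cv δv : ℝ} {p q : Site (d + 1)} (hK : Decays K C δ) (hδ : 0 < δ) (hV : BiLoc V p q Cv δv) (hδv : 0 < δv) (α β : Fin (d + 1))
    {cL cR : Fin (d + 1) → Fin (d + 1) → ℝ}
    (hL : ∀ (t : Fin (d + 1) → ℤ) (α κ : Fin (d + 1)), HasSum (fun x' : Fin (d + 1) → ℤ => K ((N : ℤ) • x') t (Sum.inr α) (Sum.inl κ)) (cL α κ))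
    (hL0 : ∀ (t : Fin (d + 1) → ℤ) (α m : Fin (d + 1)), HasSum (fun x' : Fin (d + 1) → ℤ => K ((N : ℤ) • x') t (Sum.inr α) (Sum.inr m)) 0)
    (hR : ∀ (u : Fin (d + 1) → ℤ) (κ' μ : Fin (d + 1)), HasSum (fun y : Fin (d + 1) → ℤ => K u ((N : ℤ) • y) (Sum.inl κ') (Sum.inr μ)) (cR κ' μ))
    (hR0 : ∀ (u : Fin (d + 1) → ℤ) (m μ : Fin (d + 1)), HasSum (fun y : Fin (d + 1) → ℤ => K u ((N : ℤ) • y) (Sum.inr m) (Sum.inr μ)) 0) :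
    HasSum (fun xz : Site (d + 1) × Site (d + 1) =>
        comp (comp (coDressKBmAt (toSite r) N K) V) (coDressKBmAt (toSite r) N K) ((N : ℤ) • xz.1) ((N : ℤ) • xz.2) (Sum.inr α) (Sum.inr β))
      (∑' yw : Site (d + 1) × Site (d + 1), ∑ a : Fin (d + 1), ∑ b : Fin (d + 1),
        (if yw.1 a % (N : ℤ) = (N : ℤ) - 1 then (N : ℝ) * cL α a else 0) * V yw.1 yw.2 (Sum.inl a) (Sum.inl b) *
          (if yw.2 b % (N : ℤ) = (N : ℤ) - 1 then (N : ℝ) * cR b β else 0)) := by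
  obtain ⟨δG, CG, hδG, -, hG⟩ := decays_coDressKBmAt hN hr (K := K) ⟨δ, C, hδ, hK.nonneg (Sum.inl 0), hK⟩
  have h := hasSum_sandwich_readout_dep (N := N) hG hδG hV hδv α β (hasSum_coDressKBmAt_row hN hr hL hL0 α) (hasSum_coDressKBmAt_col hN hr hR hR0 β)
  simpa only [Fintype.sum_sum_type, Sum.elim_inl, Sum.elim_inr, mul_zero, zero_mul, Finset.sum_const_zero, add_zero] using h

end CoDressed

end Summit.QuantumFields.BalabanUV.Beta.GAN24.SandwichReadoutSiteDep

end
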